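import Summits.ResolutionOfSingularities.ResolutionOfSingularities.Theses.WeightedInvariant
import Summits.ResolutionOfSingularities.ResolutionOfSingularities.Theorems.WeightedInvariantWeightedConstructionCobordantPlusSmoothVerbatim

/-!
# `WeightedConstruction` — negative lemma: the crux fails modulo a SURVIVING FAMILY

Crux `stmt-ResolutionOfSingularities-0571`,
`Summit.ResolutionOfSingularities.ResolutionOfSingularities.Theses.WeightedInvariant.WeightedConstruction`
(`∀ p prime, Nonempty (WeightedResolutionDatum p)`), route `ResolutionOfSingularities/WeightedInvariant`.
Line lead c4 (prover-line-stmt-ResolutionOfSingularities-0571-c4-0), 2026-08-17.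

THE LEVER (new with respect to the standing disprover's Parts I–III, `Cruxes/WeightedConstruction/Disproof.lean`):
for a weighted resolution datum `D`, ANY point `y` of ANY pair `(Y, X)` is a MAXIMUM point of a pair the
datum must also treat — the open sublevel set `V = {y' | inv y' ≤ inv y}` (open: its complement is the
superlevel set of the least value above `inv y`, closed by `(usc)`; axiom `(i)` for the open immersion
`V ↪ Y` identifies `inv` on `(V, X|_V)` with the restriction). So at a NON-REGULAR point `y` of `X`
(`¬ IsBot (inv y)` by `(ii)`) axioms `(iii)`/`(iv)` apply on `V`: the datum's centre on `V` is a regular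
weighted centre through `y`, supported inside the non-regular locus of `X|_V`, invariant under the
`X|_V`-preserving smooth surjective self-maps of `V`, and `inv` drops strictly below `inv y` at EVERY
point of EVERY cobordant chart `B₊(U)`, `U ⊆ V` affine, with the strict transform.

THE NEGATIVE LEMMA (`isEmpty_datum_of_survivingFamily`, `weightedConstruction_false_of_survivingFamily`):
hence NO datum exists in characteristic `p` as soon as there is a **surviving family** over one perfect
field `k` of characteristic `p` — a class `G` of pointed pairs `(Y → Spec k smooth separated
quasi-compact, X, y)` with (a) a member, (b) every member non-regular (`X` not regular at `y`), and
(c) closure under the adversary's move: for every member, every open `V ∋ y` stable under the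
`X`-preserving smooth `k`-endomorphisms of `Y`, and every regular weighted centre `R` on `V` through `y`,
supported in the non-regular locus of `X|_V` and invariant under the `X|_V`-preserving smooth surjective
`k`-endomorphisms of `V`, some point `b` of some cobordant chart `B₊^R(U)` with the strict transform is
smooth-locally equivalent over `k` (two smooth legs from one smooth separated quasi-compact `W`, equal
pull-backs) to a member. Proof: the set of values `inv` takes on members is non-empty and, by the lever
and `(iv)` + `(i)`, has no least element — against well-foundedness of `Γ`. Reproduction of one germ
(Disproof §C3.2 `not_nonempty_of_isolated_reproduction` / `…_homogeneous_reproduction`) is the case of a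
one-member family; cycles (Hauser–Perlega type) and infinite descents across growing embedding dimension
(the successors on `B₊` have one more variable at wild points, AQS arXiv:2412.16426 Rem. 5.7) are the new
cases. This is the exact negation shape of a positional winning strategy in the weighted cobordant game
on POINTED PAIRS (route item `LocalWeightedDrop`, stmt-8899, is its formal-hypersurface shadow): the
crux implies that the resolver wins that game from every position.

Declared: the hypothesis `SurvivingFamily : Prop` (the adversary object, `--negative-modulo
SurvivingFamily`; filed by the gate as a construction item), the unbundled D-free emptiness theorem
`isEmpty_datum_of_survivingFamily` (one perfect field `k`, any `p`), and the negative lemma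
`weightedConstruction_false_of_survivingFamily : SurvivingFamily → ¬ WeightedConstruction`.
-/

noncomputable section

open CategoryTheory AlgebraicGeometry TopologicalSpace
open Literature.AlgebraicGeometry.Resolution
open Summit.ResolutionOfSingularities.ResolutionOfSingularities.Theses.WeightedInvariant

set_option linter.dupNamespace false

namespace Summit.ResolutionOfSingularities.ResolutionOfSingularities.Theorems.WeightedConstruction.Negative

variable {p : ℕ} (D : WeightedResolutionDatum p)

/-! ## §1 The open-restriction lever -/

section Lever

variable {k : Type} [Field k] [CharP k p] [PerfectField k]
  {Y : Scheme.{0}} (f : Y ⟶ Spec (.of k)) [Smooth f] [IsSeparated f] [QuasiCompact f]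

/-- **The sublevel sets of `inv` are open.** The complement of `{y' | inv y' ≤ inv y}` is empty or the
superlevel set of the least value of `Γ` above `inv y` (well-order), which is closed by `(usc)`.
[folklore] -/
theorem isOpen_sublevel (X : Y.IdealSheafData) (y : Y) :
    IsOpen {y' : Y | D.inv f X y' ≤ D.inv f X y} := by
  classical
  by_cases hS : ∃ γ : D.Γ, D.inv f X y < γ
  · -- the least value above `inv y`
    let γ₀ : D.Γ := WellFounded.min wellFounded_lt {γ : D.Γ | D.inv f X y < γ} hS
    have hγ₀ : D.inv f X y < γ₀ := WellFounded.min_mem wellFounded_lt {γ : D.Γ | D.inv f X y < γ} hS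
    have hmin : ∀ γ : D.Γ, D.inv f X y < γ → γ₀ ≤ γ := fun γ hγ =>
      not_lt.mp (WellFounded.not_lt_min wellFounded_lt {γ : D.Γ | D.inv f X y < γ} hγ)
    have hcompl : {y' : Y | D.inv f X y' ≤ D.inv f X y}ᶜ = {y' : Y | γ₀ ≤ D.inv f X y'} := by
      ext y'
      simp only [Set.mem_compl_iff, Set.mem_setOf_eq, not_le]
      exact ⟨fun h => hmin _ h, fun h => hγ₀.trans_le h⟩
    rw [← isClosed_compl_iff, hcompl]
    exact D.isClosed_superlevel f X γ₀
  · have huniv : {y' : Y | D.inv f X y' ≤ D.inv f X y} = Set.univ := by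
      ext y'
      simp only [Set.mem_setOf_eq, Set.mem_univ, iff_true]
      exact not_lt.mp fun h => hS ⟨_, h⟩
    rw [huniv]
    exact isOpen_univ

/-- **The sublevel open** `V_y = {y' | inv y' ≤ inv y}` exists as an open of `Y`. [folklore] -/
theorem exists_sublevel (X : Y.IdealSheafData) (y : Y) :
    ∃ V : Y.Opens, ∀ y' : Y, y' ∈ V ↔ D.inv f X y' ≤ D.inv f X y :=
  ⟨⟨{y' : Y | D.inv f X y' ≤ D.inv f X y}, isOpen_sublevel D f X y⟩, fun _ => Iff.rfl⟩

omit [PerfectField k] in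
/-- A smooth quasi-compact scheme over a field is Noetherian. [folklore] -/
theorem isNoetherian_of_smooth (f : Y ⟶ Spec (.of k)) [Smooth f] [QuasiCompact f] :
    IsNoetherian Y := by
  haveI : IsLocallyNoetherian Y := LocallyOfFiniteType.isLocallyNoetherian f
  haveI : CompactSpace Y := QuasiCompact.compactSpace_of_compactSpace f
  exact {}

omit [PerfectField k] [IsSeparated f] in
/-- The structure map `V ↪ Y → Spec k` of an open `V` of `Y` is quasi-compact (`Y` is Noetherian, so
every open subspace is); it is smooth and separated by the instances for open immersions and
compositions. [folklore] -/
theorem quasiCompact_opens_ι_comp (V : Y.Opens) : QuasiCompact (V.ι ≫ f) := by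
  haveI : IsNoetherian Y := isNoetherian_of_smooth f
  haveI : NoetherianSpace (V : Scheme.{0}) := NoetherianSpace.set (V : Set Y)
  infer_instance

/-- `inv` of the restricted pair `(V, X|_V)` is the restriction of `inv` (axiom `(i)` for the open
immersion `V ↪ Y`). [folklore] -/
theorem inv_opens (V : Y.Opens) (X : Y.IdealSheafData) (v : (V : Scheme.{0})) :
    D.inv (V.ι ≫ f) (X.comap V.ι) v = D.inv f X v.val := by
  haveI := quasiCompact_opens_ι_comp f V
  rw [← Scheme.Opens.ι_apply]
  exact D.inv_comap f (V.ι ≫ f) V.ι rfl X v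

variable {X : Y.IdealSheafData} {y : Y} in
/-- A non-regular point of `X` is not a minimum point of `inv` (axiom `(ii)`). [folklore] -/
theorem not_isBot_of_nonregular
    (hy : ∃ x : X.subscheme, X.subschemeι x = y ∧ ¬ IsRegularLocalRing (X.subscheme.presheaf.stalk x)) :
    ¬ IsBot (D.inv f X y) := by
  rw [D.isBot_inv_iff f X y]
  intro H
  obtain ⟨x, hx, hnr⟩ := hy
  exact hnr (H x hx)

end Lever

/-! ## §2 The adversary's view of a datum at a non-regular point -/

section Move

variable {k : Type} [Field k] [CharP k p] [PerfectField k]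
  {Y : Scheme.{0}} (f : Y ⟶ Spec (.of k)) [Smooth f] [IsSeparated f] [QuasiCompact f]
  (X : Y.IdealSheafData) (y : Y)
  (V : Y.Opens) (hV : ∀ y' : Y, y' ∈ V ↔ D.inv f X y' ≤ D.inv f X y)

include hV

omit [CharP k p] [PerfectField k] [Smooth f] [IsSeparated f] [QuasiCompact f] in
/-- `y` lies in its own sublevel open. [folklore] -/
theorem mem_sublevel_self : y ∈ V := (hV y).mpr le_rfl

/-- **Open-restriction lever**: on the sublevel open `V_y`, with the restricted ideal sheaf, `y` is a
MAXIMUM point of `inv`. [folklore] -/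
theorem isMaxOn_sublevel (v : (V : Scheme.{0})) :
    D.inv (V.ι ≫ f) (X.comap V.ι) v ≤
      D.inv (V.ι ≫ f) (X.comap V.ι) ⟨y, mem_sublevel_self D f X y V hV⟩ := by
  rw [inv_opens, inv_opens]
  exact (hV _).mp v.2

/-- **The sublevel open is stable under the symmetries of the pair**: every smooth `k`-endomorphism
`σ` of `Y` with `X.comap σ = X` preserves `inv` (axiom `(i)`), hence maps `V_y` into itself and its
complement into itself. [folklore] -/
theorem mem_sublevel_apply_iff (σ : Y ⟶ Y) [Smooth σ] (hσ : σ ≫ f = f) (hX : X.comap σ = X) (y' : Y) :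
    σ y' ∈ V ↔ y' ∈ V := by
  have h := D.inv_comap f f σ hσ X y'
  rw [hX] at h
  rw [hV, hV, ← h]

variable {X y} in
/-- The guard of axioms `(iii)`/`(iv)` holds on the sublevel open of a non-regular point. [folklore] -/
theorem guard_sublevel
    (hy : ∃ x : X.subscheme, X.subschemeι x = y ∧ ¬ IsRegularLocalRing (X.subscheme.presheaf.stalk x)) :
    ∃ v : (V : Scheme.{0}), ¬ IsBot (D.inv (V.ι ≫ f) (X.comap V.ι) v) := by
  refine ⟨⟨y, mem_sublevel_self D f X y V hV⟩, ?_⟩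
  rw [inv_opens]
  exact not_isBot_of_nonregular D f hy

variable {X y} in
/-- **The datum's centre at a non-regular point, seen by the adversary.** Let `y` be a non-regular
point of `X`, `V = V_y` its sublevel open, `X_V = X|_V` and `R` the datum's centre of `(V, X_V)`. Then:
`R` is a regular weighted centre; `y ∈ supp R`; `supp R` lies in the non-regular locus of `X_V`;
`R` is invariant under every smooth surjective `k`-endomorphism of `V` preserving `X_V`; every
cobordant chart `B₊^R(U) → U ⊆ V ⊆ Y → Spec k` (`U ⊆ V` affine) is smooth, separated and
quasi-compact (Włodarczyk 2.3.9, landed as `SupportFirst.stub_cobordantPlus_smooth`); and at every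
point `b` of every such chart, with the strict transform of `X_V`, the invariant is STRICTLY BELOW
`inv y`. [folklore] -/
theorem centre_sublevel
    (hy : ∃ x : X.subscheme, X.subschemeι x = y ∧ ¬ IsRegularLocalRing (X.subscheme.presheaf.stalk x)) :
    let R : ReesAlgebraData (V : Scheme.{0}) := D.centre (V.ι ≫ f) (X.comap V.ι)
    R.IsRegularWeightedCentre ∧
    (⟨y, mem_sublevel_self D f X y V hV⟩ : (V : Scheme.{0})) ∈ R.support ∧
    (∀ v ∈ R.support, ∃ x : (X.comap V.ι).subscheme, (X.comap V.ι).subschemeι x = v ∧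
      ¬ IsRegularLocalRing ((X.comap V.ι).subscheme.presheaf.stalk x)) ∧
    (∀ (σ : (V : Scheme.{0}) ⟶ V) [Smooth σ] [Surjective σ], σ ≫ V.ι ≫ f = V.ι ≫ f →
      (X.comap V.ι).comap σ = X.comap V.ι → ∀ n : ℕ, (R.piece n).comap σ = R.piece n) ∧
    (∀ U : (V : Scheme.{0}).affineOpens,
      Smooth (R.cobordantPlusι U ≫ V.ι ≫ f) ∧ IsSeparated (R.cobordantPlusι U ≫ V.ι ≫ f) ∧
        QuasiCompact (R.cobordantPlusι U ≫ V.ι ≫ f)) ∧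
    (∀ (U : (V : Scheme.{0}).affineOpens) (b : R.cobordantPlus U),
      D.inv (R.cobordantPlusι U ≫ V.ι ≫ f) (R.cobordantStrictTransform U (X.comap V.ι)) b <
        D.inv f X y) := by
  intro R
  haveI := quasiCompact_opens_ι_comp f V
  have hguard := guard_sublevel D f V hV hy
  have hreg : R.IsRegularWeightedCentre := D.isRegularWeightedCentre_centre (V.ι ≫ f) _ hguard
  have hsupp := D.support_centre (V.ι ≫ f) (X.comap V.ι) hguard
  have hmax := isMaxOn_sublevel D f X y V hV
  refine ⟨hreg, ?_, ?_, ?_, ?_, ?_⟩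
  · -- `y` is a maximum point on `V`, hence in the support of the centre
    show _ ∈ (D.centre (V.ι ≫ f) (X.comap V.ι)).support
    rw [hsupp]
    exact hmax
  · -- maximum points are non-minimal, hence non-regular points of `X_V` by `(ii)`
    intro v hv
    change v ∈ (D.centre (V.ι ≫ f) (X.comap V.ι)).support at hv
    rw [hsupp] at hv
    have hnb : ¬ IsBot (D.inv (V.ι ≫ f) (X.comap V.ι) v) :=
      D.not_isBot_of_isMaxOn (V.ι ≫ f) (X.comap V.ι) hguard hv
    rw [D.isBot_inv_iff (V.ι ≫ f) (X.comap V.ι) v] at hnb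
    by_contra hcon
    apply hnb
    intro x hx
    by_contra hnr
    exact hcon ⟨x, hx, hnr⟩
  · -- invariance of the centre under the symmetries of `(V, X_V)` (axiom `(i)` for the centre)
    intro σ _ _ hσ hXσ n
    have h := D.centre_comap (V.ι ≫ f) (V.ι ≫ f) σ hσ (X.comap V.ι) hguard n
    rw [hXσ] at h
    exact h.symm
  · -- the charts are again in the regime (Włodarczyk 2.3.9, landed)
    intro U
    exact SupportFirst.stub_cobordantPlus_smooth (V.ι ≫ f) R hreg U
  · -- the drop `(iv)` on `V`, compared with `inv y = max_V inv`
    intro U b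
    have hlt := D.inv_cobordantPlus_lt (V.ι ≫ f) (X.comap V.ι) hguard U b
      ⟨y, mem_sublevel_self D f X y V hV⟩ hmax
    rw [inv_opens] at hlt
    exact hlt

end Move

/-! ## §3 The negative lemma -/

/-- **No datum in characteristic `p` if a surviving family exists** (D-free). Hypotheses: a class `G`
of pointed pairs over one perfect field `k` of characteristic `p` (`Y → Spec k` smooth separated
quasi-compact, `X` an ideal sheaf on `Y`, `y ∈ Y`) such that (a) `hne`: it has a member; (b) `hsing`:
at every member `X` is not regular at `y`; (c) `hsucc`: for every member, every open `V ∋ y` of `Y`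
stable under the `X`-preserving smooth `k`-endomorphisms of `Y`, and every regular weighted centre `R`
on `V` with `y ∈ supp R ⊆` the non-regular locus of `X|_V`, invariant under the `X|_V`-preserving smooth
surjective `k`-endomorphisms of `V`, and all of whose cobordant charts `B₊(U) → Spec k` are smooth,
separated and quasi-compact, SOME point `b` of SOME chart `B₊^R(U)` with the strict transform of `X|_V`
is smooth-locally equivalent over `k` to a member (smooth legs `g₁ : W → B₊(U)`, `g₂ : W → Y'` from a
smooth separated quasi-compact `W` with equal pull-backs and a point `w` over `b` and `y'`). Then
`WeightedResolutionDatum p` is empty: by §2 and axioms `(iv)`+`(i)` every member has a member of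
strictly smaller `inv`, so the (non-empty) set of values of `inv` on members has no least element,
contradicting well-foundedness of `Γ`. [folklore] -/
theorem isEmpty_datum_of_survivingFamily {k : Type} [Field k] [CharP k p] [PerfectField k]
    (G : ∀ ⦃Y : Scheme.{0}⦄, (Y ⟶ Spec (.of k)) → Y.IdealSheafData → Y → Prop)
    (hne : ∃ (Y : Scheme.{0}) (f : Y ⟶ Spec (.of k)) (_ : Smooth f) (_ : IsSeparated f)
      (_ : QuasiCompact f) (X : Y.IdealSheafData) (y : Y), G f X y)
    (hsing : ∀ ⦃Y : Scheme.{0}⦄ (f : Y ⟶ Spec (.of k)) [Smooth f] [IsSeparated f] [QuasiCompact f]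
      (X : Y.IdealSheafData) (y : Y), G f X y →
      ∃ x : X.subscheme, X.subschemeι x = y ∧ ¬ IsRegularLocalRing (X.subscheme.presheaf.stalk x))
    (hsucc : ∀ ⦃Y : Scheme.{0}⦄ (f : Y ⟶ Spec (.of k)) [Smooth f] [IsSeparated f] [QuasiCompact f]
      (X : Y.IdealSheafData) (y : Y), G f X y →
      ∀ (V : Y.Opens) (hyV : y ∈ V),
        (∀ (σ : Y ⟶ Y) [Smooth σ], σ ≫ f = f → X.comap σ = X → ∀ y' : Y, σ y' ∈ V ↔ y' ∈ V) →
        ∀ R : ReesAlgebraData (V : Scheme.{0}), R.IsRegularWeightedCentre →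
          (⟨y, hyV⟩ : (V : Scheme.{0})) ∈ R.support →
          (∀ v ∈ R.support, ∃ x : (X.comap V.ι).subscheme, (X.comap V.ι).subschemeι x = v ∧
            ¬ IsRegularLocalRing ((X.comap V.ι).subscheme.presheaf.stalk x)) →
          (∀ (σ : (V : Scheme.{0}) ⟶ V) [Smooth σ] [Surjective σ], σ ≫ V.ι ≫ f = V.ι ≫ f →
            (X.comap V.ι).comap σ = X.comap V.ι → ∀ n : ℕ, (R.piece n).comap σ = R.piece n) →
          (∀ U : (V : Scheme.{0}).affineOpens,
            Smooth (R.cobordantPlusι U ≫ V.ι ≫ f) ∧ IsSeparated (R.cobordantPlusι U ≫ V.ι ≫ f) ∧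
              QuasiCompact (R.cobordantPlusι U ≫ V.ι ≫ f)) →
          ∃ (U : (V : Scheme.{0}).affineOpens) (b : R.cobordantPlus U)
            (W : Scheme.{0}) (h : W ⟶ Spec (.of k)) (_ : Smooth h) (_ : IsSeparated h)
            (_ : QuasiCompact h)
            (g₁ : W ⟶ R.cobordantPlus U) (_ : Smooth g₁) (_ : g₁ ≫ R.cobordantPlusι U ≫ V.ι ≫ f = h)
            (Y' : Scheme.{0}) (f' : Y' ⟶ Spec (.of k)) (_ : Smooth f') (_ : IsSeparated f')
            (_ : QuasiCompact f') (X' : Y'.IdealSheafData) (y' : Y')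
            (g₂ : W ⟶ Y') (_ : Smooth g₂) (_ : g₂ ≫ f' = h) (w : W),
            G f' X' y' ∧ g₁ w = b ∧ g₂ w = y' ∧
              (R.cobordantStrictTransform U (X.comap V.ι)).comap g₁ = X'.comap g₂) :
    IsEmpty (WeightedResolutionDatum p) := by
  classical
  refine ⟨fun D => ?_⟩
  -- the values of `inv` on members
  let S : Set D.Γ := {γ | ∃ (Y : Scheme.{0}) (f : Y ⟶ Spec (.of k)) (_ : Smooth f)
    (_ : IsSeparated f) (_ : QuasiCompact f) (X : Y.IdealSheafData) (y : Y),
    G f X y ∧ D.inv f X y = γ}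
  have hS : S.Nonempty := by
    obtain ⟨Y, f, i₁, i₂, i₃, X, y, hG⟩ := hne
    exact ⟨D.inv f X y, Y, f, i₁, i₂, i₃, X, y, hG, rfl⟩
  -- a member of least value
  obtain ⟨Y, f, i₁, i₂, i₃, X, y, hG, hγ⟩ := WellFounded.min_mem wellFounded_lt S hS
  -- the datum's move at that member, seen by the adversary (§2) on the sublevel open `V_y`
  have hy := hsing f X y hG
  obtain ⟨V, hV⟩ := exists_sublevel D f X y
  obtain ⟨hreg, hyR, hsuppR, hinvR, hregime, hdrop⟩ := centre_sublevel D f V hV hy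
  obtain ⟨U, b, W, h, j₁, j₂, j₃, g₁, l₁, hg₁, Y', f', i₁', i₂', i₃', X', y', g₂, l₂, hg₂, w,
      hG', hw₁, hw₂, hX⟩ :=
    hsucc f X y hG V (mem_sublevel_self D f X y V hV)
      (fun σ _ hσ hXσ y' => mem_sublevel_apply_iff D f X y V hV σ hσ hXσ y')
      (D.centre (V.ι ≫ f) (X.comap V.ι)) hreg hyR hsuppR
      (fun σ _ _ hσ hXσ n => hinvR σ hσ hXσ n) hregime
  -- the successor member has strictly smaller `inv`: `(iv)` on the sublevel open, then `(i)` twice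
  obtain ⟨k₁, k₂, k₃⟩ := hregime U
  have hlt := hdrop U b
  have h₁ := D.inv_comap ((D.centre (V.ι ≫ f) (X.comap V.ι)).cobordantPlusι U ≫ V.ι ≫ f) h g₁ hg₁
    ((D.centre (V.ι ≫ f) (X.comap V.ι)).cobordantStrictTransform U (X.comap V.ι)) w
  have h₂ := D.inv_comap f' h g₂ hg₂ X' w
  rw [hX, hw₁] at h₁
  rw [hw₂] at h₂
  rw [← h₁, h₂, hγ] at hlt
  -- … contradicting minimality
  have hmem : D.inv f' X' y' ∈ S := ⟨Y', f', i₁', i₂', i₃', X', y', hG', rfl⟩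
  exact WellFounded.not_lt_min wellFounded_lt S hmem hlt

/-- **The adversary object: a surviving family** (hypothesis `H` of the negative lemma). At some
PRIME `p`, over some perfect field `k` of characteristic `p`, a class `G` of pointed pairs
(`f : Y → Spec k` smooth separated quasi-compact, `X` an ideal sheaf on `Y`, `y ∈ Y`) with:
(a) a member; (b) at every member `X` is NOT regular at `y` (some point of `X.subscheme` over `y` has a
non-regular local ring); (c) closure under the adversary's move — for every member, every open `V ∋ y`
of `Y` stable under the `X`-preserving smooth `k`-endomorphisms of `Y`, and every regular weighted
centre `R` on `V` (Włodarczyk 2.1.10, `ReesAlgebraData.IsRegularWeightedCentre`) with `y ∈ supp R`,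
`supp R` inside the non-regular locus of `X|_V`, `R` invariant under the `X|_V`-preserving smooth
surjective `k`-endomorphisms of `V`, and all cobordant charts `B₊^R(U) → Spec k` smooth separated
quasi-compact, SOME point `b` of SOME chart `B₊^R(U)` (Włodarczyk Def. 2.3.5), with the strict
transform of `X|_V` (3.3.12), is smooth-locally equivalent over `k` to a member: smooth `k`-legs
`g₁ : W → B₊^R(U)`, `g₂ : W → Y'` from one smooth separated quasi-compact `W` with equal pull-backs of
the two ideal sheaves and a point `w ∈ W` over `b` and `y'`. Informally: a set of singular germ types,
closed under "every admissible weighted cobordant blow-up has a successor in the set" — a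
counter-strategy to the resolver in the weighted cobordant game on pointed pairs (reproduction of one
germ, a Hauser–Perlega-type cycle, or an infinite descent through growing embedding dimension would
each be one). None is known at any prime. HYPOTHESIS of this negative lemma (filed `--negative-modulo
SurvivingFamily`); not a Literature fact (notions: Włodarczyk arXiv:2203.03090 Def. 2.3.5, 2.1.10, 3.3.12). -/
def SurvivingFamily : Prop :=
  ∃ p : ℕ, p.Prime ∧ ∃ (k : Type) (_ : Field k) (_ : CharP k p) (_ : PerfectField k)
    (G : ∀ ⦃Y : Scheme.{0}⦄, (Y ⟶ Spec (.of k)) → Y.IdealSheafData → Y → Prop),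
    (∃ (Y : Scheme.{0}) (f : Y ⟶ Spec (.of k)) (_ : Smooth f) (_ : IsSeparated f)
      (_ : QuasiCompact f) (X : Y.IdealSheafData) (y : Y), G f X y) ∧
    (∀ ⦃Y : Scheme.{0}⦄ (f : Y ⟶ Spec (.of k)) [Smooth f] [IsSeparated f] [QuasiCompact f]
      (X : Y.IdealSheafData) (y : Y), G f X y →
      ∃ x : X.subscheme, X.subschemeι x = y ∧ ¬ IsRegularLocalRing (X.subscheme.presheaf.stalk x)) ∧
    (∀ ⦃Y : Scheme.{0}⦄ (f : Y ⟶ Spec (.of k)) [Smooth f] [IsSeparated f] [QuasiCompact f]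
      (X : Y.IdealSheafData) (y : Y), G f X y →
      ∀ (V : Y.Opens) (hyV : y ∈ V),
        (∀ (σ : Y ⟶ Y) [Smooth σ], σ ≫ f = f → X.comap σ = X → ∀ y' : Y, σ y' ∈ V ↔ y' ∈ V) →
        ∀ R : ReesAlgebraData (V : Scheme.{0}), R.IsRegularWeightedCentre →
          (⟨y, hyV⟩ : (V : Scheme.{0})) ∈ R.support →
          (∀ v ∈ R.support, ∃ x : (X.comap V.ι).subscheme, (X.comap V.ι).subschemeι x = v ∧
            ¬ IsRegularLocalRing ((X.comap V.ι).subscheme.presheaf.stalk x)) →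
          (∀ (σ : (V : Scheme.{0}) ⟶ V) [Smooth σ] [Surjective σ], σ ≫ V.ι ≫ f = V.ι ≫ f →
            (X.comap V.ι).comap σ = X.comap V.ι → ∀ n : ℕ, (R.piece n).comap σ = R.piece n) →
          (∀ U : (V : Scheme.{0}).affineOpens,
            Smooth (R.cobordantPlusι U ≫ V.ι ≫ f) ∧ IsSeparated (R.cobordantPlusι U ≫ V.ι ≫ f) ∧
              QuasiCompact (R.cobordantPlusι U ≫ V.ι ≫ f)) →
          ∃ (U : (V : Scheme.{0}).affineOpens) (b : R.cobordantPlus U)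
            (W : Scheme.{0}) (h : W ⟶ Spec (.of k)) (_ : Smooth h) (_ : IsSeparated h)
            (_ : QuasiCompact h)
            (g₁ : W ⟶ R.cobordantPlus U) (_ : Smooth g₁) (_ : g₁ ≫ R.cobordantPlusι U ≫ V.ι ≫ f = h)
            (Y' : Scheme.{0}) (f' : Y' ⟶ Spec (.of k)) (_ : Smooth f') (_ : IsSeparated f')
            (_ : QuasiCompact f') (X' : Y'.IdealSheafData) (y' : Y')
            (g₂ : W ⟶ Y') (_ : Smooth g₂) (_ : g₂ ≫ f' = h) (w : W),
            G f' X' y' ∧ g₁ w = b ∧ g₂ w = y' ∧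
              (R.cobordantStrictTransform U (X.comap V.ι)).comap g₁ = X'.comap g₂)

/-- **`WeightedConstruction` is false modulo a surviving family** (the negative lemma
`<Decl>_false_of_<H>`): a surviving family at one prime (hypothesis `SurvivingFamily`) empties
`WeightedResolutionDatum p` there (`isEmpty_datum_of_survivingFamily`: open-restriction lever,
axioms `(iii)`/`(iv)`/`(i)`, well-foundedness of `Γ`), hence refutes
`WeightedConstruction = ∀ p prime, Nonempty (WeightedResolutionDatum p)`. In characteristic `0` no
surviving family exists (Abramovich–Temkin–Włodarczyk 2024 Thm. 1.1.1 / Włodarczyk arXiv:2203.03090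
Thm. 1.1.4 supply a datum); in characteristic `p` its existence is the negation shape of the open
problem (ATW 2024 §1.9). [folklore] -/
theorem weightedConstruction_false_of_survivingFamily : SurvivingFamily → ¬ WeightedConstruction := by
  rintro ⟨p, hp, k, _, _, _, G, hne, hsing, hsucc⟩ hC
  exact (isEmpty_datum_of_survivingFamily G hne hsing hsucc).false (hC p hp).some

end Summit.ResolutionOfSingularities.ResolutionOfSingularities.Theorems.WeightedConstruction.Negative

end
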